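import Summits.ABC.ABC.Theorems.TwistAmplificationMazurKaneLawRecordInstanceR32
import Summits.ABC.ABC.Theorems.TwistAmplificationMazurKaneLawRecordLPR1p

-- `Summit.ABC.ABC` is the mandated summit-side namespace (single-conjunct summit); the lakefile sets the same option.
set_option linter.dupNamespace false

/-!
# Record exponent `R1p` for crux `TwistAmplification.MazurKaneLaw` (stmt-ABC-2757): the instance

Line `fibre-toolkit-lp-wall-map`, record pipeline step 2 (INSTANCE) at `(J, s₀, Vc) = (4, 1001/1000, 31/50)` (the
abc-hit record `0.62 < 13/20`): `Toolkit.RecordInstance 4 (1001/1000) (31/50)`. For shape data in dimension `4 + e`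
with the standing hypotheses of the exponent dictionary, the determinant tool beyond `P₀` and the two square-root
lattice tools, the exponents `aⱼ = α x_{j-1}`, `bⱼ = β x_{j-1}`, `cⱼ = γ x_{j-1}` (`j ≤ 4`, `x_k = Fin.castAdd e k`),
the totals `A, B, C`, the deficits `d_a = 1 − log_Λ(c₁ · shapeVal X)`, `d_b`, `d_c`, `D = log_Λ B_d` and the slack
`σ = recordSlack 4 (4+e) Λ Dτ P₀ t (1001/1000)` (`Λ = 2C₀`) satisfy the hypotheses of the generated LP lemma
`lp_R1p`, whence `log_Λ B_d ≤ 31/50 + σ`. Pattern of the landed twin `recordInstance_R32` (same `J = 4`, whose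
helpers `term_facts_four` etc. are reused verbatim); the 28 tools are two determinant entries (`det_linear`, levels
`2, 3`), three Fourier entries (`AbcShapes.fourier_linear`; saved sets `{2, 4}` for `e_T = 2`, `{3}` for `e_T = 3`),
ten subset geometry-of-numbers entries (`AbcShapes.geometry_disjunction`), ten square-root lattice entries
(`sqrtLattice_linear`, hosts `x`, `y` via `shapeCount_swap`, `z`) and the three trivial entries
(`AbcShapes.trivial_linear`); every dictionary loss is absorbed in `σ`.
-/

noncomputable section

open Finset
open Literature.NumberTheory.DiophantineGeometry
open Literature.NumberTheory.DiophantineGeometry.AbcShapes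

namespace Summit.ABC.ABC.Theorems.MazurKaneLaw

open Summit.ABC.ABC.Theorems.MazurKaneLaw.Toolkit

/-- **Record instance `R1p`: `RecordInstance 4 (1001/1000) (31/50)`.** With `Λ = 2C₀`, the exponents of the data
satisfy the hypotheses of `lp_R1p` with the slack `σ = recordSlack 4 (4+e) Λ Dτ P₀ t (1001/1000)`: structure
(`term_facts_four`, `C₀ ≤ V₂ c₃ shapeVal Z`, `∏ XᵢYᵢZᵢ ≤ Λ^t`), the determinant entries at levels `2, 3`, three Fourier
entries, ten geometry entries, ten square-root lattice entries and the three trivial entries; every loss is `≤ σ`.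
[folklore] -/
theorem recordInstance_R1p :
    Summit.ABC.ABC.Theorems.MazurKaneLaw.Toolkit.RecordInstance 4 (1001 / 1000) (31 / 50) := by
  -- adapted from `recordInstance_R32` (TwistAmplificationMazurKaneLawRecordInstanceR32.lean)
  intro e c₁ c₂ c₃ C₀ hc₁ hc₂ hc₃ hC₀ X Y Z hX hY hZ T Dτ hTX hTY hTZ hD hC₀le hvX hvY hvZ t hP hB0 P₀ hP₀
    hdet hQX hQZ hσm
  classical
  obtain ⟨Λ, hΛdef⟩ : ∃ Λ : ℝ, Λ = 2 * C₀ := ⟨_, rfl⟩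
  rw [← hΛdef] at hP hσm ⊢
  obtain ⟨σ, hσdef⟩ : ∃ σ : ℝ, recordSlack 4 (4 + e) Λ Dτ P₀ t (1001 / 1000) = σ := ⟨_, rfl⟩
  rw [hσdef] at hσm ⊢
  /- positivity of the scale and of the loss terms; the slack -/
  have hC₀' : (1 : ℝ) ≤ C₀ := by exact_mod_cast hC₀
  have hΛ : 1 < Λ := by rw [hΛdef]; linarith only [hC₀']
  have hΛ0 : 0 < Λ := by linarith only [hΛ]
  have hDτ : 1 ≤ Dτ := by
    have h1 : (1 : ℕ) ≤ T :=
      le_trans (Nat.mul_pos hc₃ (shapeVal_pos fun i => Nat.mul_pos two_pos (hZ i))) hTZ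
    simpa using hD 1 one_ne_zero h1
  have hBr : (0 : ℝ) < shapeCount c₁ c₂ c₃ X Y Z := by exact_mod_cast hB0
  have he0 : (0 : ℝ) ≤ (e : ℝ) := Nat.cast_nonneg _
  have hdd : ((4 + e : ℕ) : ℝ) = 4 + (e : ℝ) := by push_cast; ring
  have hlD0 : 0 ≤ Real.logb Λ Dτ := Real.logb_nonneg hΛ (by exact_mod_cast hDτ)
  have hV2pos : 0 < shapeVal (fun _ : Fin (4 + e) => 2) := shapeVal_pos fun _ => two_pos
  have hlV0 : 0 ≤ Real.logb Λ ((shapeVal (fun _ : Fin (4 + e) => 2) : ℕ) : ℝ) :=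
    Real.logb_nonneg hΛ (by exact_mod_cast Nat.one_le_iff_ne_zero.mpr hV2pos.ne')
  obtain ⟨hl20, hl27, hl48, hl114, hl480⟩ : 0 ≤ Real.logb Λ 2 ∧ 0 ≤ Real.logb Λ 27 ∧ 0 ≤ Real.logb Λ 48 ∧
      0 ≤ Real.logb Λ 114 ∧ 0 ≤ Real.logb Λ 480 := by
    refine ⟨?_, ?_, ?_, ?_, ?_⟩ <;> exact Real.logb_nonneg hΛ (by norm_num)
  have hlP0 : 0 ≤ Real.logb Λ P₀ := Real.logb_nonneg hΛ hP₀
  obtain ⟨m, hmdef⟩ : ∃ m : ℝ, max (t - 1001 / 1000) 0 = m := ⟨_, rfl⟩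
  have hmax0 : 0 ≤ m := by rw [← hmdef]; exact le_max_right _ _
  have hmax1 : t - 1001 / 1000 ≤ m := by rw [← hmdef]; exact le_max_left _ _
  have hσ' : σ = (12 * (4 + (e : ℝ)) + 22) * Real.logb Λ Dτ + 30 * Real.logb Λ 2 +
      Real.logb Λ ((shapeVal (fun _ : Fin (4 + e) => 2) : ℕ) : ℝ) + Real.logb Λ 27 + Real.logb Λ 48 +
      Real.logb Λ 114 + Real.logb Λ 480 + Real.logb Λ P₀ + m := by
    have h480 : (24 : ℝ) * 4 * (4 + 1) = 480 := by norm_num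
    rw [← hσdef, recordSlack, hmdef]; push_cast; rw [h480]; ring
  have hDl0 : 0 ≤ (12 * (4 + (e : ℝ)) + 22) * Real.logb Λ Dτ := mul_nonneg (by linarith only [he0]) hlD0
  have hσ0 : 0 ≤ σ := by rw [hσ']; linarith only [hDl0, hl20, hlV0, hl27, hl48, hl114, hl480, hlP0, hmax0]
  /- the four special coordinates `x0, …, x3` (levels `1, …, 4`): values, distinctness, the finite sums used -/
  obtain ⟨x0, hx0⟩ : ∃ k : Fin (4 + e), Fin.castAdd e 0 = k := ⟨_, rfl⟩
  obtain ⟨x1, hx1⟩ : ∃ k : Fin (4 + e), Fin.castAdd e 1 = k := ⟨_, rfl⟩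
  obtain ⟨x2, hx2⟩ : ∃ k : Fin (4 + e), Fin.castAdd e 2 = k := ⟨_, rfl⟩
  obtain ⟨x3, hx3⟩ : ∃ k : Fin (4 + e), Fin.castAdd e 3 = k := ⟨_, rfl⟩
  obtain ⟨hv0n, hv1n, hv2n, hv3n⟩ : (x0 : ℕ) = 0 ∧ (x1 : ℕ) = 1 ∧ (x2 : ℕ) = 2 ∧ (x3 : ℕ) = 3 := by
    rw [← hx0, ← hx1, ← hx2, ← hx3]; exact ⟨rfl, rfl, rfl, rfl⟩
  obtain ⟨hv0, hv1, hv2⟩ : ((x0 : ℕ) : ℝ) = 0 ∧ ((x1 : ℕ) : ℝ) = 1 ∧ ((x2 : ℕ) : ℝ) = 2 := by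
    rw [hv0n, hv1n, hv2n]; norm_num
  obtain ⟨hi1, hi2, hi3, hi13, hi23, hi33⟩ : 1 ≤ (x1 : ℕ) ∧ 1 ≤ (x2 : ℕ) ∧ 1 ≤ (x3 : ℕ) ∧ (x1 : ℕ) ≤ 3 ∧
      (x2 : ℕ) ≤ 3 ∧ (x3 : ℕ) ≤ 3 := by omega
  obtain ⟨h01, h02, h12, h13⟩ : x0 ≠ x1 ∧ x0 ≠ x2 ∧ x1 ≠ x2 ∧ x1 ≠ x3 := by
    refine ⟨?_, ?_, ?_, ?_⟩ <;> exact fun h => absurd (congrArg Fin.val h) (by omega)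
  have eP : ∀ {p q : Fin (4 + e)}, p ≠ q → ∀ f : Fin (4 + e) → ℝ,
      ∑ i ∈ ({p, q} : Finset (Fin (4 + e))), f i = f p + f q := fun h _ => sum_pair h
  have e012 := sum_three h01 h02 h12
  /- the LP variables: exponents `α, β, γ`, totals `A, B, C`, `D`, deficits `da, db, dc`; the structure -/
  obtain ⟨α, hα⟩ : ∃ f : Fin (4 + e) → ℝ, expo Λ X = f := ⟨_, rfl⟩
  obtain ⟨β, hβ⟩ : ∃ f : Fin (4 + e) → ℝ, expo Λ Y = f := ⟨_, rfl⟩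
  obtain ⟨γ, hγ⟩ : ∃ f : Fin (4 + e) → ℝ, expo Λ Z = f := ⟨_, rfl⟩
  obtain ⟨A, hA⟩ : ∃ r : ℝ, ∑ i, α i = r := ⟨_, rfl⟩
  obtain ⟨B, hB⟩ : ∃ r : ℝ, ∑ i, β i = r := ⟨_, rfl⟩
  obtain ⟨C, hC⟩ : ∃ r : ℝ, ∑ i, γ i = r := ⟨_, rfl⟩
  obtain ⟨D, hDn⟩ : ∃ r : ℝ, Real.logb Λ (shapeCount c₁ c₂ c₃ X Y Z) = r := ⟨_, rfl⟩
  obtain ⟨da, hLX⟩ : ∃ r : ℝ, Real.logb Λ ((c₁ * shapeVal X : ℕ) : ℝ) = 1 - r := ⟨_, (sub_sub_cancel 1 _).symm⟩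
  obtain ⟨db, hLY⟩ : ∃ r : ℝ, Real.logb Λ ((c₂ * shapeVal Y : ℕ) : ℝ) = 1 - r := ⟨_, (sub_sub_cancel 1 _).symm⟩
  obtain ⟨dc, hLZ⟩ : ∃ r : ℝ, Real.logb Λ ((c₃ * shapeVal Z : ℕ) : ℝ) = 1 - r := ⟨_, (sub_sub_cancel 1 _).symm⟩
  have hLrad : radExp Λ X Y Z = A + B + C := by
    rw [radExp, sum_add_distrib, sum_add_distrib, hα, hβ, hγ, hA, hB, hC]
  have hdefic : deficiency Λ c₁ c₂ c₃ X Y Z = da + db + dc := by rw [deficiency, hLX, hLY, hLZ]; ring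
  obtain ⟨hα0, hTa, hda0, hda1, hWa⟩ := term_facts_four hc₁ hX hΛ hΛdef hvX hα hx0 hx1 hx2 hx3 hA hLX
  obtain ⟨hβ0, hTb, hdb0, hdb1, hWb⟩ := term_facts_four hc₂ hY hΛ hΛdef hvY hβ hx0 hx1 hx2 hx3 hB hLY
  obtain ⟨hγ0, hTc, hdc0, -, hWc⟩ := term_facts_four hc₃ hZ hΛ hΛdef hvZ hγ hx0 hx1 hx2 hx3 hC hLZ
  -- `dc ≤ σ`: `C₀ ≤ V₂ · c₃ shapeVal Z` and `log_Λ C₀ = 1 − log_Λ 2`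
  have hdcσ : dc ≤ σ := by
    have h3 : Real.logb Λ (C₀ : ℝ) ≤ Real.logb Λ ((shapeVal (fun _ : Fin (4 + e) => 2) : ℕ) : ℝ) +
        Real.logb Λ ((c₃ * shapeVal Z : ℕ) : ℝ) := by
      rw [← logb_natMul hV2pos (Nat.mul_pos hc₃ (shapeVal_pos hZ))]
      exact logb_natMono hΛ (by omega) hC₀le
    have h4 : Real.logb Λ (C₀ : ℝ) = 1 - Real.logb Λ 2 := by
      have : (C₀ : ℝ) = Λ / 2 := by rw [hΛdef]; ring
      rw [this, Real.logb_div hΛ0.ne' two_ne_zero, Real.logb_self_eq_one hΛ]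
    rw [hLZ] at h3
    linarith only [h3, h4, hσ', hDl0, hl20, hlV0, hl27, hl48, hl114, hl480, hlP0, hmax0]
  /- the radical: `A + B + C = log_Λ ∏ XᵢYᵢZᵢ ≤ t ≤ 1001/1000 + (t − 1001/1000)₊` -/
  have hL : A + B + C ≤ (1001 / 1000 : ℝ) + σ := by
    have hp : ∀ i, (0 : ℝ) < X i ∧ (0 : ℝ) < Y i ∧ (0 : ℝ) < Z i := fun i =>
      ⟨by exact_mod_cast hX i, by exact_mod_cast hY i, by exact_mod_cast hZ i⟩
    have hpos : ∀ i, (0 : ℝ) < (X i : ℝ) * Y i * Z i := fun i => by obtain ⟨h1, h2, h3⟩ := hp i; positivity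
    have hlog := Real.logb_le_logb_of_le hΛ (prod_pos fun i _ => hpos i) hP
    rw [Real.logb_rpow hΛ0 hΛ.ne', Real.logb_prod _ _ fun i _ => (hpos i).ne'] at hlog
    have hsum : ∑ i, Real.logb Λ ((X i : ℝ) * Y i * Z i) = A + B + C := by
      rw [← hLrad, radExp]
      refine sum_congr rfl fun i _ => ?_
      obtain ⟨h1, h2, h3⟩ := hp i
      rw [Real.logb_mul (by positivity) h3.ne', Real.logb_mul h1.ne' h2.ne']; rfl
    linarith only [hlog, hsum, hmax1, hσ', hDl0, hl20, hlV0, hl27, hl48, hl114, hl480, hlP0]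
  /- the trivial entries `D ≤ A + B + σ`, `D ≤ A + C + σ`, `D ≤ B + C + σ` -/
  obtain ⟨hT1, hT2, hT3⟩ := trivial_linear hc₁ hc₂ hc₃ hX hY hZ hTX hTY hTZ hD hΛ hB0
  have hd1 : (4 + (e : ℝ)) * Real.logb Λ Dτ ≤ (12 * (4 + (e : ℝ)) + 22) * Real.logb Λ Dτ :=
    mul_le_mul_of_nonneg_right (by linarith only [he0]) hlD0
  have h_T_ab : D ≤ A + B + σ := by
    rw [hα, hβ, hA, hB, hDn, hdd] at hT1
    linarith only [hT1, hd1, hσ', hl20, hlV0, hl27, hl48, hl114, hl480, hlP0, hmax0]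
  have h_T_ac : D ≤ A + C + σ := by
    rw [hα, hγ, hA, hC, hDn, hdd] at hT2
    linarith only [hT2, hd1, hσ', hl20, hlV0, hl27, hl48, hl114, hl480, hlP0, hmax0]
  have h_T_bc : D ≤ B + C + σ := by
    rw [hβ, hγ, hB, hC, hDn, hdd] at hT3
    linarith only [hT3, hd1, hσ', hl20, hlV0, hl27, hl48, hl114, hl480, hlP0, hmax0]
  /- the determinant entries at levels `2, 3` (coordinates `x1, x2`) -/
  have hDt : ∀ (i : Fin (4 + e)) {v : ℝ}, 1 ≤ (i : ℕ) → ((i : ℕ) : ℝ) = v → 24 * ((v + 1) * (v + 2)) ≤ 480 →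
      3 * v + 6 ≤ 12 * (4 + (e : ℝ)) + 22 →
      D ≤ A + B + C - (α i + β i + γ i) + σ ∨
        D ≤ A + B + C - 1 + ((v - 1) * (α i + β i + γ i) + (da + db + dc)) / 3 + σ := by
    intro i v hi hv h480 hk
    have h := det_linear hc₁ hc₂ hc₃ hX hY hZ hDτ hΛ hB0 i (hdet i hi)
    have hl : Real.logb Λ (24 * ((v + 1) * (v + 2))) ≤ Real.logb Λ 480 :=
      Real.logb_le_logb_of_le hΛ (by rw [← hv]; positivity) h480
    rw [hLrad, hdefic, hDn, hα, hβ, hγ, hv] at h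
    have hk' : (3 * v + 6) * Real.logb Λ Dτ ≤ (12 * (4 + (e : ℝ)) + 22) * Real.logb Λ Dτ :=
      mul_le_mul_of_nonneg_right hk hlD0
    exact h.imp (fun h => by linarith only [h, hl, hk', hσ', hl20, hlV0, hl27, hl48, hl114, hlP0, hmax0])
      fun h => by linarith only [h, hl, hk', hσ', hl20, hlV0, hl27, hl48, hl114, hlP0, hmax0]
  have h_Dt_2 : D ≤ -α x1 - β x1 - γ x1 + A + B + C + σ ∨
      D ≤ A + B + C + 1 / 3 * da + 1 / 3 * db + 1 / 3 * dc - 1 + σ :=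
    (hDt x1 hi1 hv1 (by norm_num) (by linarith only [he0])).imp (fun h => by linarith only [h])
      fun h => by linarith only [h]
  have h_Dt_3 : D ≤ -α x2 - β x2 - γ x2 + A + B + C + σ ∨ D ≤ 1 / 3 * α x2 + 1 / 3 * β x2 + 1 / 3 * γ x2 +
      A + B + C + 1 / 3 * da + 1 / 3 * db + 1 / 3 * dc - 1 + σ :=
    (hDt x2 hi2 hv2 (by norm_num) (by linarith only [he0])).imp (fun h => by linarith only [h])
      fun h => by linarith only [h]
  /- the Fourier entries (saved sets: `{x1, x3}` for `e_T = 2`, `{x2}` for `e_T = 3`) -/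
  have hF : ∀ {SU SV SW : Finset (Fin (4 + e))},
      (∃ n, 2 ≤ n ∧ ∀ i ∈ SU, n ∣ (i : ℕ) + 1) → (∃ n, 2 ≤ n ∧ ∀ i ∈ SV, n ∣ (i : ℕ) + 1) →
      (∃ n, 2 ≤ n ∧ ∀ i ∈ SW, n ∣ (i : ℕ) + 1) →
      ∑ i ∈ SU, α i + ∑ i ∈ SV, β i + ∑ i ∈ SW, γ i ≤ 4 * (A + B + C) - 6 * D + σ := by
    rintro SU SV SW ⟨nU, hnU, hSU⟩ ⟨nV, hnV, hSV⟩ ⟨nW, hnW, hSW⟩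
    have h := fourier_linear hc₁ hc₂ hc₃ hX hY hZ hTX hTY hTZ hD hΛ hB0 SU SV SW hnU hnV hnW hSU hSV hSW
    rw [hdd, hα, hβ, hγ, hA, hB, hC, hDn] at h
    have h19 : (12 * (4 + (e : ℝ)) + 3) * Real.logb Λ Dτ ≤ (12 * (4 + (e : ℝ)) + 22) * Real.logb Λ Dτ :=
      mul_le_mul_of_nonneg_right (by linarith only [he0]) hlD0
    linarith only [h, h19, hσ', hl20, hlV0, hl48, hl114, hl480, hlP0, hmax0]
  have o2 : ∃ n, 2 ≤ n ∧ ∀ i ∈ ({x1, x3} : Finset (Fin (4 + e))), n ∣ (i : ℕ) + 1 :=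
    ⟨2, le_rfl, fun i hi => by rw [mem_insert, mem_singleton] at hi; rcases hi with rfl | rfl <;> omega⟩
  have o3 : ∃ n, 2 ≤ n ∧ ∀ i ∈ ({x2} : Finset (Fin (4 + e))), n ∣ (i : ℕ) + 1 :=
    ⟨3, by norm_num, fun i hi => by rw [mem_singleton] at hi; subst hi; omega⟩
  have h_F_222 : α x1 + α x3 + β x1 + β x3 + γ x1 + γ x3 ≤ 4 * (A + B + C) - 6 * D + σ := by
    have f := hF o2 o2 o2; simp only [eP h13] at f; linarith only [f]
  have h_F_323 : α x2 + β x1 + β x3 + γ x2 ≤ 4 * (A + B + C) - 6 * D + σ := by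
    have f := hF o3 o2 o3; simp only [eP h13, sum_singleton] at f; linarith only [f]
  have h_F_332 : α x2 + β x2 + γ x1 + γ x3 ≤ 4 * (A + B + C) - 6 * D + σ := by
    have f := hF o3 o3 o2; simp only [eP h13, sum_singleton] at f; linarith only [f]
  /- the subset geometry-of-numbers entries (index sets inside the first three coordinates) -/
  obtain ⟨R, hR⟩ : ∃ r : ℝ, A + B + C - D + σ = r := ⟨_, rfl⟩
  have hG : ∀ (I J K : Finset (Fin (4 + e))), (8 + ∑ i ∈ I, ((i : ℕ) + 1 : ℝ) + ∑ i ∈ J, ((i : ℕ) + 1 : ℝ)) ≤ 30 →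
      (∑ i ∈ I, α i + ∑ i ∈ J, β i + ∑ i ∈ K, γ i ≤ R) ∨
      (1 - (∑ i ∈ I, (i : ℝ) * α i + ∑ i ∈ J, (i : ℝ) * β i + ∑ i ∈ K, (i : ℝ) * γ i) ≤ R) := by
    intro I J K hIJ
    have h30 : (8 + ∑ i ∈ I, ((i : ℕ) + 1 : ℝ) + ∑ i ∈ J, ((i : ℕ) + 1 : ℝ)) * Real.logb Λ 2 ≤
        30 * Real.logb Λ 2 := mul_le_mul_of_nonneg_right hIJ hl20
    have h3d : 3 * (4 + (e : ℝ)) * Real.logb Λ Dτ ≤ (12 * (4 + (e : ℝ)) + 22) * Real.logb Λ Dτ :=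
      mul_le_mul_of_nonneg_right (by linarith only [he0]) hlD0
    have g := geometry_disjunction hc₁ hc₂ hc₃ hX hY hZ hTX hTY hTZ hD hΛ hB0 hC₀ hΛdef hC₀le I J K le_rfl
    rw [hdd, hα, hβ, hγ, hA, hB, hC, hDn] at g
    exact g.imp (fun g => by linarith only [g, h30, h3d, hσ', hR, hl27, hl48, hl114, hl480, hlP0, hmax0])
      fun g => by linarith only [g, h30, h3d, hσ', hR, hl27, hl48, hl114, hl480, hlP0, hmax0]
  have h_G_a1a2b1b2b3c1c2 : α x0 + α x1 + β x0 + β x1 + β x2 + γ x0 + γ x1 ≤ R ∨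
      1 - (α x1 + β x1 + 2 * β x2 + γ x1) ≤ R := by
    have g := hG {x0, x1} {x0, x1, x2} {x0, x1}; simp only [eP h01, e012, hv0, hv1, hv2] at g
    refine (g (by norm_num)).imp ?_ ?_ <;> intro g <;> linarith only [g]
  have h_G_a1a2b1b2c1 : α x0 + α x1 + β x0 + β x1 + γ x0 ≤ R ∨ 1 - (α x1 + β x1) ≤ R := by
    have g := hG {x0, x1} {x0, x1} {x0}; simp only [eP h01, sum_singleton, hv0, hv1] at g
    refine (g (by norm_num)).imp ?_ ?_ <;> intro g <;> linarith only [g]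
  have h_G_a1a2b1b3c1 : α x0 + α x1 + β x0 + β x2 + γ x0 ≤ R ∨ 1 - (α x1 + 2 * β x2) ≤ R := by
    have g := hG {x0, x1} {x0, x2} {x0}; simp only [eP h01, eP h02, sum_singleton, hv0, hv1, hv2] at g
    refine (g (by norm_num)).imp ?_ ?_ <;> intro g <;> linarith only [g]
  have h_G_a1a2b1c1c2 : α x0 + α x1 + β x0 + γ x0 + γ x1 ≤ R ∨ 1 - (α x1 + γ x1) ≤ R := by
    have g := hG {x0, x1} {x0} {x0, x1}; simp only [eP h01, sum_singleton, hv0, hv1] at g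
    refine (g (by norm_num)).imp ?_ ?_ <;> intro g <;> linarith only [g]
  have h_G_a1a3b1b2c1c3 : α x0 + α x2 + β x0 + β x1 + γ x0 + γ x2 ≤ R ∨
      1 - (2 * α x2 + β x1 + 2 * γ x2) ≤ R := by
    have g := hG {x0, x2} {x0, x1} {x0, x2}; simp only [eP h02, eP h01, hv0, hv1, hv2] at g
    refine (g (by norm_num)).imp ?_ ?_ <;> intro g <;> linarith only [g]
  have h_G_a1a3b1c1 : α x0 + α x2 + β x0 + γ x0 ≤ R ∨ 1 - (2 * α x2) ≤ R := by
    have g := hG {x0, x2} {x0} {x0}; simp only [eP h02, sum_singleton, hv0, hv2] at g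
    refine (g (by norm_num)).imp ?_ ?_ <;> intro g <;> linarith only [g]
  have h_G_a1b1b3c1 : α x0 + β x0 + β x2 + γ x0 ≤ R ∨ 1 - (2 * β x2) ≤ R := by
    have g := hG {x0} {x0, x2} {x0}; simp only [eP h02, sum_singleton, hv0, hv2] at g
    refine (g (by norm_num)).imp ?_ ?_ <;> intro g <;> linarith only [g]
  have h_G_a1b1b3c1c2 : α x0 + β x0 + β x2 + γ x0 + γ x1 ≤ R ∨ 1 - (2 * β x2 + γ x1) ≤ R := by
    have g := hG {x0} {x0, x2} {x0, x1}; simp only [eP h02, eP h01, sum_singleton, hv0, hv1, hv2] at g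
    refine (g (by norm_num)).imp ?_ ?_ <;> intro g <;> linarith only [g]
  have h_G_a1b1c1 : α x0 + β x0 + γ x0 ≤ R ∨ 1 - (0 : ℝ) ≤ R := by
    have g := hG {x0} {x0} {x0}; simp only [sum_singleton, hv0] at g
    refine (g (by norm_num)).imp ?_ ?_ <;> intro g <;> linarith only [g]
  have h_G_a1b1c1c2 : α x0 + β x0 + γ x0 + γ x1 ≤ R ∨ 1 - (γ x1) ≤ R := by
    have g := hG {x0} {x0} {x0, x1}; simp only [eP h01, sum_singleton, hv0, hv1] at g
    refine (g (by norm_num)).imp ?_ ?_ <;> intro g <;> linarith only [g]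
  /- the square-root lattice entries: hosts `x` (tool `Q_X`), `y` (`Q_X` on the swapped datum), `z` (`Q_Z`); the loss
  `(d + i + 2) log Dτ + log 114` at `i ≤ 3` is `≤ σ` -/
  have hQσ : ∀ {i : Fin (4 + e)} {L1 L2 : ℝ}, (i : ℕ) ≤ 3 →
      (D ≤ L1 + ((4 + (e : ℝ) + (i : ℕ) + 2) * Real.logb Λ Dτ + Real.logb Λ 114) ∨
        D ≤ L2 + ((4 + (e : ℝ) + (i : ℕ) + 2) * Real.logb Λ Dτ + Real.logb Λ 114)) →
      D ≤ L1 + σ ∨ D ≤ L2 + σ := by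
    intro i L1 L2 hi h
    have hi' : ((i : ℕ) : ℝ) ≤ 3 := by exact_mod_cast hi
    have h9 : (4 + (e : ℝ) + (i : ℕ) + 2) * Real.logb Λ Dτ ≤ (12 * (4 + (e : ℝ)) + 22) * Real.logb Λ Dτ :=
      mul_le_mul_of_nonneg_right (by linarith only [he0, hi']) hlD0
    exact h.imp (fun h => by linarith only [h, h9, hσ', hl20, hlV0, hl27, hl48, hl480, hlP0, hmax0])
      fun h => by linarith only [h, h9, hσ', hl20, hlV0, hl27, hl48, hl480, hlP0, hmax0]
  have hQa : ∀ (H : Finset (Fin (4 + e))) (i : Fin (4 + e)), 1 ≤ (i : ℕ) → (i : ℕ) ≤ 3 →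
      D ≤ A + B + C - (1 - da) + ∑ j ∈ H, (j : ℝ) * α j + σ ∨
        D ≤ A + B + C - (∑ j ∈ H, α j + β i + γ i) + σ := by
    intro H i hi hi3
    have q := sqrtLattice_linear hc₁ hX hY hZ hDτ hΛ hBr H i
      (hQX hc₁ hc₂ hc₃ X Y Z hX hY hZ hTX hTY hTZ hD H i hi)
    rw [hα, hβ, hγ, hA, hB, hC, hDn, hLX, hdd] at q
    exact hQσ hi3 q
  have hBr' : (0 : ℝ) < shapeCount c₂ c₁ c₃ Y X Z := by rw [← shapeCount_swap c₁ c₂ c₃ X Y Z]; exact hBr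
  have hQb : ∀ (H : Finset (Fin (4 + e))) (i : Fin (4 + e)), 1 ≤ (i : ℕ) → (i : ℕ) ≤ 3 →
      D ≤ B + A + C - (1 - db) + ∑ j ∈ H, (j : ℝ) * β j + σ ∨
        D ≤ B + A + C - (∑ j ∈ H, β j + α i + γ i) + σ := by
    intro H i hi hi3
    have q := sqrtLattice_linear hc₂ hY hX hZ hDτ hΛ hBr' H i
      (hQX hc₂ hc₁ hc₃ Y X Z hY hX hZ hTY hTX hTZ hD H i hi)
    rw [← shapeCount_swap c₁ c₂ c₃ X Y Z, hα, hβ, hγ, hA, hB, hC, hDn, hLY, hdd] at q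
    exact hQσ hi3 q
  have hQc : ∀ (H : Finset (Fin (4 + e))) (i : Fin (4 + e)), 1 ≤ (i : ℕ) → (i : ℕ) ≤ 3 →
      D ≤ C + A + B - (1 - dc) + ∑ j ∈ H, (j : ℝ) * γ j + σ ∨
        D ≤ C + A + B - (∑ j ∈ H, γ j + α i + β i) + σ := by
    intro H i hi hi3
    have hq' := hQZ hc₁ hc₂ hc₃ X Y Z hX hY hZ hTX hTY hTZ hD H i hi
    rw [← mul_rotate (subBox H Z).card] at hq'
    have q := sqrtLattice_linear hc₃ hZ hX hY hDτ hΛ hBr H i hq'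
    rw [hα, hβ, hγ, hA, hB, hC, hDn, hLZ, hdd] at q
    exact hQσ hi3 q
  have h_Q_a_123_4 : D ≤ α x1 + 2 * α x2 + A + B + C + da - 1 + σ ∨
      D ≤ -α x0 - α x1 - α x2 - β x3 - γ x3 + A + B + C + σ := by
    have q := hQa {x0, x1, x2} x3 hi3 hi33; simp only [e012, hv0, hv1, hv2] at q
    refine q.imp ?_ ?_ <;> intro q <;> linarith only [q]
  have h_Q_a_12_3 : D ≤ α x1 + A + B + C + da - 1 + σ ∨ D ≤ -α x0 - α x1 - β x2 - γ x2 + A + B + C + σ := by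
    have q := hQa {x0, x1} x2 hi2 hi23; simp only [eP h01, hv0, hv1] at q
    refine q.imp ?_ ?_ <;> intro q <;> linarith only [q]
  have h_Q_a_12_4 : D ≤ α x1 + A + B + C + da - 1 + σ ∨ D ≤ -α x0 - α x1 - β x3 - γ x3 + A + B + C + σ := by
    have q := hQa {x0, x1} x3 hi3 hi33; simp only [eP h01, hv0, hv1] at q
    refine q.imp ?_ ?_ <;> intro q <;> linarith only [q]
  have h_Q_b_1_4 : D ≤ A + B + C + db - 1 + σ ∨ D ≤ -α x3 - β x0 - γ x3 + A + B + C + σ := by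
    have q := hQb {x0} x3 hi3 hi33; simp only [sum_singleton, hv0] at q
    refine q.imp ?_ ?_ <;> intro q <;> linarith only [q]
  have h_Q_c_12_3 : D ≤ γ x1 + A + B + C + dc - 1 + σ ∨ D ≤ -α x2 - β x2 - γ x0 - γ x1 + A + B + C + σ := by
    have q := hQc {x0, x1} x2 hi2 hi23; simp only [eP h01, hv0, hv1] at q
    refine q.imp ?_ ?_ <;> intro q <;> linarith only [q]
  have h_Q_c_12_4 : D ≤ γ x1 + A + B + C + dc - 1 + σ ∨ D ≤ -α x3 - β x3 - γ x0 - γ x1 + A + B + C + σ := by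
    have q := hQc {x0, x1} x3 hi3 hi33; simp only [eP h01, hv0, hv1] at q
    refine q.imp ?_ ?_ <;> intro q <;> linarith only [q]
  have h_Q_c_13_2 : D ≤ 2 * γ x2 + A + B + C + dc - 1 + σ ∨ D ≤ -α x1 - β x1 - γ x0 - γ x2 + A + B + C + σ := by
    have q := hQc {x0, x2} x1 hi1 hi13; simp only [eP h02, hv0, hv2] at q
    refine q.imp ?_ ?_ <;> intro q <;> linarith only [q]
  have h_Q_c_13_4 : D ≤ 2 * γ x2 + A + B + C + dc - 1 + σ ∨ D ≤ -α x3 - β x3 - γ x0 - γ x2 + A + B + C + σ := by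
    have q := hQc {x0, x2} x3 hi3 hi33; simp only [eP h02, hv0, hv2] at q
    refine q.imp ?_ ?_ <;> intro q <;> linarith only [q]
  have h_Q_c_1_2 : D ≤ A + B + C + dc - 1 + σ ∨ D ≤ -α x1 - β x1 - γ x0 + A + B + C + σ := by
    have q := hQc {x0} x1 hi1 hi13; simp only [sum_singleton, hv0] at q
    refine q.imp ?_ ?_ <;> intro q <;> linarith only [q]
  have h_Q_c_1_3 : D ≤ A + B + C + dc - 1 + σ ∨ D ≤ -α x2 - β x2 - γ x0 + A + B + C + σ := by
    have q := hQc {x0} x2 hi2 hi23; simp only [sum_singleton, hv0] at q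
    refine q.imp ?_ ?_ <;> intro q <;> linarith only [q]
  /- the linear programme -/
  subst hR
  rw [hDn]
  exact lp_R1p (hα0 x0) (hα0 x1) (hα0 x2) (hα0 x3) (hβ0 x0) (hβ0 x1) (hβ0 x2) (hβ0 x3) (hγ0 x0) (hγ0 x1) (hγ0 x2)
    (hγ0 x3) hTa hTb hTc hWa hda0 hda1 hWb hdb0 hdb1 hWc hdc0 hdcσ hσ0 hσm hL h_Dt_2 h_Dt_3 h_F_222 h_F_323 h_F_332
    h_G_a1a2b1b2b3c1c2 h_G_a1a2b1b2c1 h_G_a1a2b1b3c1 h_G_a1a2b1c1c2 h_G_a1a3b1b2c1c3 h_G_a1a3b1c1 h_G_a1b1b3c1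
    h_G_a1b1b3c1c2 h_G_a1b1c1 h_G_a1b1c1c2 h_Q_a_123_4 h_Q_a_12_3 h_Q_a_12_4 h_Q_b_1_4 h_Q_c_12_3 h_Q_c_12_4
    h_Q_c_13_2 h_Q_c_13_4 h_Q_c_1_2 h_Q_c_1_3 h_T_ab h_T_ac h_T_bc

end Summit.ABC.ABC.Theorems.MazurKaneLaw

end
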